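import Mathlib
import Summits.ValiantsHypothesis.ValiantsHypothesis.Theorems.FifoMatchingNNMonotoneHardQueue
import HarnessLib

/-!
# Route FifoMatching — crux `NNLinearDegreeCofactorHard` (stmt-ValiantsHypothesis-23918), line
# `internal_cofactor`, stub S2b (ii): BOUNDARY TESTS ACROSS PUSH-BLOCKS, WITH AND WITHOUT DEFECT EXEMPTION

Unit (C′) of the S2b(ii) measure design of record (`Lines/internal_cofactor-S2b-measure-constraints.md` §5,
ruling director-valiant g10 2026-08-28T01:07:58Z): the queue-word measure fixes the letters at the defect
positions `R` to be PUSHES, so a colour boundary of the split met by the word may have a block of forced pushes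
between its two free letters.  This file extends the landed boundary test (piece (C) of the `NNMonotoneHard`
proof, `NNMonotoneHard.boundary_test`: adjacent positions `s−1, s`) to that situation, in both interfaces:

* `card_closers_lt_of_pushes` — if every letter strictly between `s′ < s` is a push, the closer rank at `s`
  is the closer rank at `s′` plus `[W s′ = D]` (the front of the queue does not move across pushes);
* `boundary_test_across` — ORDINARY interface (p3's `AvoidingSpread`: every arc monochromatic): at a colour
  boundary `σ s′ ≠ σ s`, `s′ < s`, only pushes strictly between, queue nonempty at `s′` with front `f = o_k`,
  `k = #closers<s′`, the letter pair `(W s′, W s)` avoids `if σ f = σ s then (D,U) else (U,D)` — the landed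
  pattern, dictated by the strict past;
* `boundary_test_across_offR` — DEFECT interface (p4's `DefectSpread`: only arcs with both ends off `R`
  are constrained): the same conclusion under the extra hypotheses `s′, s ∉ R` and `f ∉ R` ("V-front");
* `respectsOff_fifo_iff` — the defect event `∀ i ∉ R, fifo i ∉ R → (i ∈ I ↔ fifo i ∈ I)` read on arc
  indices, as `respects_fifo_iff` does for ordinary events.

Pricing (not here): with the block test lemma `…BlockTests.card_filter_blockAvoid_le` (p592179) each such
boundary costs a factor `≤ 1 − f/2^b` once the excluded letter pair is translated into the forbidden code set of
the design's letter coding (unit (C′-d), after the SPEC of the coding).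

Honest framing: bookkeeping for ONE unit of an OPEN stub's measure construction; nothing here proves S2b, the
crux, `NNDivisionHard`, `NNNotVP` or VP ≠ VNP (monotone ≠ general,
`Literature.Barriers.ValiantsHypothesis.MonotoneGap`).  No definitions, no named facts.
-/

noncomputable section

-- Sub = Summit single-conjunct layout: the duplicated namespace component is mandated by the tree.
set_option linter.dupNamespace false

namespace Summit.ValiantsHypothesis.ValiantsHypothesis.Theorems.FifoMatching.NNLinearDegreeCofactorHard.BoundaryTests

open Finset Literature.Computability.AlgebraicComplexity
open Summit.ValiantsHypothesis.ValiantsHypothesis.Theorems.FifoMatching.NNMonotoneHard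

variable {M : ℕ} {W : Fin M → Bool}

/-! ### The closer rank across a block of pushes -/

/-- **Across a block of pushes the front does not move**: if every letter strictly between `s′ < s` is a
push, then `#closers<s = #closers<s′ + [W s′ = D]`. [folklore] -/
theorem card_closers_lt_of_pushes {s' s : Fin M} (hlt : s' < s)
    (hmid : ∀ i : Fin M, s' < i → i < s → W i = true) :
    ((closerSet W).filter fun i => i < s).card
      = ((closerSet W).filter fun i => i < s').card + (if W s' = false then 1 else 0) := by
  classical
  have hwin := card_filter_lt_sub (closerSet W) hlt.le
  have hset : ((closerSet W).filter fun i => s' ≤ i ∧ i < s) =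
      (if W s' = false then {s'} else ∅) := by
    ext i
    simp only [mem_filter, mem_closerSet]
    constructor
    · rintro ⟨hWi, hle, hlt'⟩
      rcases hle.eq_or_lt with h | h
      · subst h
        rw [if_pos hWi]
        exact mem_singleton_self _
      · exact absurd (hmid i h hlt') (by rw [hWi]; exact Bool.false_ne_true)
    · intro hi
      split_ifs at hi with hW
      · rw [mem_singleton] at hi
        subst hi
        exact ⟨hW, le_rfl, hlt⟩
      · exact absurd hi (notMem_empty _)
  rw [hset] at hwin
  have hmono := card_filter_lt_mono (closerSet W) hlt.le
  split_ifs at hwin with hW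
  · rw [card_singleton] at hwin; rw [if_pos hW]; omega
  · rw [card_empty] at hwin; rw [if_neg hW]; omega

/-! ### The boundary test across a push-block: ordinary interface -/

/-- **Boundary test across a block of pushes (every arc monochromatic).**  Let `W` be a word with as
many closers as openers whose FIFO pairing respects the colouring `σ` (`σ (o_k) = σ (c_k)` for all `k`),
let `s′ < s` with only pushes strictly between, `σ s′ ≠ σ s`, and let `k = #closers<s′` be an arc index,
`f = o_k` (the front at time `s′` when the queue is nonempty).  If `σ f = σ s` then `W s′ ≠ D` (a closer at
`s′` closes the arc of `f` at a time of the other colour); if `σ f ≠ σ s` then `(W s′, W s) ≠ (U, D)` (after a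
push at `s′` and the forced pushes the front at `s` is still `f`).  [folklore] -/
theorem boundary_test_across {h : (closerSet W).card = (openerSet W).card} (σ : Fin M → Bool)
    (hresp : ∀ k : Fin (openerSet W).card,
      σ ((openerSet W).orderEmbOfFin rfl k) = σ ((closerSet W).orderEmbOfFin h k))
    {s' s : Fin M} (hlt : s' < s) (hmid : ∀ i : Fin M, s' < i → i < s → W i = true)
    (hσ : σ s' ≠ σ s)
    (k : Fin (openerSet W).card) (hk : (k : ℕ) = ((closerSet W).filter fun i => i < s').card) :
    (W s', W s) ≠
      (if σ ((openerSet W).orderEmbOfFin rfl k) = σ s then (false, true) else (true, false)) := by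
  split_ifs with hf
  · intro hpair
    have hW : W s' = false := (Prod.mk.injEq _ _ _ _ ▸ hpair).1
    have hc : (closerSet W).orderEmbOfFin h k = s' := closer_eq_orderEmbOfFin hW k hk
    have := hresp k
    rw [hc, hf] at this
    exact hσ this.symm
  · intro hpair
    have hW' : W s' = true := (Prod.mk.injEq _ _ _ _ ▸ hpair).1
    have hW : W s = false := (Prod.mk.injEq _ _ _ _ ▸ hpair).2
    have hstep := card_closers_lt_of_pushes (W := W) hlt hmid
    have hk' : (k : ℕ) = ((closerSet W).filter fun i => i < s).card := by
      rw [hstep, hW']; simpa using hk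
    have hc : (closerSet W).orderEmbOfFin h k = s := closer_eq_orderEmbOfFin hW k hk'
    have := hresp k
    rw [hc] at this
    exact hf this

/-! ### The boundary test across a push-block: defect interface (V-front) -/

/-- **Boundary test with defect exemption ("V-front").**  As `boundary_test_across`, but the pairing is
only required to respect `σ` on arcs with BOTH endpoints off the defect set `R`; the conclusion holds at
boundaries `s′ < s` off `R` whose front `f = o_k` is off `R`.  [folklore] -/
theorem boundary_test_across_offR {h : (closerSet W).card = (openerSet W).card} (σ : Fin M → Bool)
    (R : Finset (Fin M))
    (hresp : ∀ k : Fin (openerSet W).card, (openerSet W).orderEmbOfFin rfl k ∉ R →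
      (closerSet W).orderEmbOfFin h k ∉ R →
        σ ((openerSet W).orderEmbOfFin rfl k) = σ ((closerSet W).orderEmbOfFin h k))
    {s' s : Fin M} (hlt : s' < s) (hmid : ∀ i : Fin M, s' < i → i < s → W i = true)
    (hs'R : s' ∉ R) (hsR : s ∉ R) (hσ : σ s' ≠ σ s)
    (k : Fin (openerSet W).card) (hk : (k : ℕ) = ((closerSet W).filter fun i => i < s').card)
    (hfront : (openerSet W).orderEmbOfFin rfl k ∉ R) :
    (W s', W s) ≠
      (if σ ((openerSet W).orderEmbOfFin rfl k) = σ s then (false, true) else (true, false)) := by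
  split_ifs with hf
  · intro hpair
    have hW : W s' = false := (Prod.mk.injEq _ _ _ _ ▸ hpair).1
    have hc : (closerSet W).orderEmbOfFin h k = s' := closer_eq_orderEmbOfFin hW k hk
    have := hresp k hfront (by rw [hc]; exact hs'R)
    rw [hc, hf] at this
    exact hσ this.symm
  · intro hpair
    have hW' : W s' = true := (Prod.mk.injEq _ _ _ _ ▸ hpair).1
    have hW : W s = false := (Prod.mk.injEq _ _ _ _ ▸ hpair).2
    have hstep := card_closers_lt_of_pushes (W := W) hlt hmid
    have hk' : (k : ℕ) = ((closerSet W).filter fun i => i < s).card := by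
      rw [hstep, hW']; simpa using hk
    have hc : (closerSet W).orderEmbOfFin h k = s := closer_eq_orderEmbOfFin hW k hk'
    have := hresp k hfront (by rw [hc]; exact hsR)
    rw [hc] at this
    exact hf this

/-- The adjacent case of `boundary_test_across_offR` (`s = s′ + 1`, no letters between), the exact defect
analogue of `NNMonotoneHard.boundary_test`. [folklore] -/
theorem boundary_test_offR {h : (closerSet W).card = (openerSet W).card} (σ : Fin M → Bool)
    (R : Finset (Fin M))
    (hresp : ∀ k : Fin (openerSet W).card, (openerSet W).orderEmbOfFin rfl k ∉ R →
      (closerSet W).orderEmbOfFin h k ∉ R →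
        σ ((openerSet W).orderEmbOfFin rfl k) = σ ((closerSet W).orderEmbOfFin h k))
    {s' s : Fin M} (hs : (s : ℕ) = s' + 1)
    (hs'R : s' ∉ R) (hsR : s ∉ R) (hσ : σ s' ≠ σ s)
    (k : Fin (openerSet W).card) (hk : (k : ℕ) = ((closerSet W).filter fun i => i < s').card)
    (hfront : (openerSet W).orderEmbOfFin rfl k ∉ R) :
    (W s', W s) ≠
      (if σ ((openerSet W).orderEmbOfFin rfl k) = σ s then (false, true) else (true, false)) :=
  boundary_test_across_offR σ R hresp (Fin.lt_def.2 (by omega))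
    (fun i h1 h2 => absurd (Fin.lt_def.1 h2) (by have := Fin.lt_def.1 h1; omega)) hs'R hsR hσ k hk hfront

/-! ### The defect event on arc indices -/

/-- **The defect event read on arc indices.**  A FIFO pairing respects `I` off `R`
(`∀ i ∉ R, fifo i ∉ R → (i ∈ I ↔ fifo i ∈ I)`) iff for every `k` with `o_k, c_k ∉ R` the `k`-th opener and
the `k`-th closer lie on the same side of `I`. [folklore] -/
theorem respectsOff_fifo_iff {h : (closerSet W).card = (openerSet W).card} (R I : Finset (Fin M)) :
    (∀ i, i ∉ R → fifo W h i ∉ R → (i ∈ I ↔ fifo W h i ∈ I)) ↔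
      ∀ k : Fin (openerSet W).card, (openerSet W).orderEmbOfFin rfl k ∉ R →
        (closerSet W).orderEmbOfFin h k ∉ R →
          ((openerSet W).orderEmbOfFin rfl k ∈ I ↔ (closerSet W).orderEmbOfFin h k ∈ I) := by
  constructor
  · intro hI k ho hc
    have := hI ((openerSet W).orderEmbOfFin rfl k) ho
    rw [fifo_opener] at this
    exact this hc
  · intro hI i hi hfi
    by_cases hw : W i = true
    · obtain ⟨k, rfl⟩ := exists_eq_opener hw
      rw [fifo_opener] at hfi ⊢
      exact hI k hi hfi
    · obtain ⟨k, rfl⟩ := exists_eq_closer h (Bool.eq_false_iff.2 hw)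
      rw [fifo_closer] at hfi ⊢
      exact (hI k hfi hi).symm

end Summit.ValiantsHypothesis.ValiantsHypothesis.Theorems.FifoMatching.NNLinearDegreeCofactorHard.BoundaryTests

end
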